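import Summits.Ventures.CertifiedManyBodySolver.Downfold.EmeryAxialSlabHg1201P10SubsA
import Summits.Ventures.CertifiedManyBodySolver.Downfold.EmeryAxialSlabHg1201P10SubsC
import Summits.Ventures.CertifiedManyBodySolver.Downfold.EmeryAxialSlabHg1201P10SubsB
import Summits.Ventures.CertifiedManyBodySolver.Downfold.EmeryFermiFillingLa214
import HarnessLib

/-!
# HgBa₂CuO₄ at P = 10 GPa (box #19 §P-INTERVALS column): HOW MUCH AXIAL (Cu-4s / apical) ADMIXTURE DOES THE BOX'S ONE-BAND FERMI SURFACE REQUIRE? — the certified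
# co-shift census of the typed 3BE one-body box `emeryBoxHg1201P10` against its object-E row `t′/t ∈ [-0.57, -0.46]`

Venture CertifiedManyBodySolver, cell `pub/hubbard-downfold` (stage S1, HUMAN RULINGS D-0096/D-0098: the 3 → 1 reduction error is carried explicitly),
seat hubbard-downfold-mod-4 (technique B = band level); namespace `Summit.Ventures.CertifiedManyBodySolver.Downfold.Emery`. Everything PROVED; numerics
decided by the kernel in `EmeryAxialSlabHg1201P10SubsA`, `EmeryAxialSlabHg1201P10SubsC`, `EmeryAxialSlabHg1201P10SubsB`.

CONTEXT. `EmeryFermiFilling…` certified the σ three-band (d–p_x–p_y + t_pp, t_pp′) Fermi-surface `t′/t` window of this box at its own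
hole count and compared it with the box's object-E row (router/BOXES/HgBa2CuO4.md object-E row «tp/t (E) [−0.57, −0.46]»). `EmeryAxialFermiSurfaceShape` +
`EmeryAxialConductionBand` (TRANSFER THEOREM `condBand_le_iff`, no separation hypothesis) prove that the four-orbital model of [AndersenEtAl1995] /
[PavariniEtAl2001] — Cu-4s (and through it the apical orbitals) added to the σ model — has, AT ITS FERMI LEVEL, exactly the conduction-band occupied
set, filling and Fermi surface of the σ model with CO-SHIFTED O–O hoppings `(t_pp + a, t_pp′ + a)`, ONE scalar `a = a_F = t_sp²/(ε_s − ε_F) ≥ 0`.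
So «how much axial channel does the one-band FS of record require beyond the box's σ rows?» is a one-parameter question, answered here slab by slab
(sub-box rule version B, `EmeryFermiFillingSubBoxB`; edges 0, 0.15, 0.3, 0.35, 0.4, 0.45, 0.5, 0.6 eV; Δ_pd × t_pd split 4 × 1):

| slab | a (eV) | ε_F window (eV above ε_d) | certified t′/t window | vs E row [-0.57, -0.46] |
|---|---|---|---|---|
| 0 | [0, 0.15] | [1.44, 2.9] | [-0.3762, -0.2412] | SHORT |
| 1 | [0.15, 0.3] | [1.38, 2.8] | [-0.4267, -0.3021] | SHORT |
| 2 | [0.3, 0.35] | [1.4, 2.66] | [-0.4375, -0.3429] | SHORT |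
| 3 | [0.35, 0.4] | [1.38, 2.62] | [-0.4496, -0.3541] | SHORT |
| 4 | [0.4, 0.45] | [1.36, 2.62] | [-0.4621, -0.3645] | MEETS |
| 5 | [0.45, 0.5] | [1.34, 2.58] | [-0.4722, -0.374] | MEETS |
| 6 | [0.5, 0.6] | [1.3, 2.6] | [-0.4945, -0.3822] | MEETS |

READING (certified, numbers not adjectives): `a ∈ [0, 0.4]` ⇒ the co-shifted Fermi surface is STILL LESS cuprate-like than the E row (`t′/t > -0.46`): the REQUIRED axial admixture at the Fermi level is `a_F > 0.4` eV (`emeryBoxHg1201P10_axial_short`). The four-orbital form of the exclusion(s) is `emeryBoxHg1201P10_fourOrbital_short`: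
for ANY axial level `ε_s` and coupling `t_sp`, a four-orbital completion of a box point whose conduction band holds the box's electrons at a Fermi level `ε_F < ε_s`
with `t_sp²/(ε_s − ε_F)` in the excluded range does NOT reproduce the E row. (Pavarini's range parameter for the PURE four-orbital model is
`r = ½/(1 + s)`, `s = (ε_s − ε_F)(ε_F − ε_p)/(2t_sp)² = (ε_F + Δ_pd)/(4·a_total)`, where `a_total` would be the WHOLE O–O co-shift; the box's `t_pp, t_pp′` rows
already contain part of the axial channel when they come from a three-band Wannier fit, so `a_F` here is the ADDITIONAL admixture — a model-form
distance, not a material constant.)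

WHAT THIS IS NOT: not a statement that the material's parameters ARE in the box (SCREENING-GRADE provenance); `U = 0` band kinematics; no phase
sentence; the E row is a [float] literature refit. Sources: [AndersenEtAl1995, §§5–6]; [PavariniEtAl2001, Eqs. (1)–(3), Fig. 3];
[HybertsenSchluterChristensen1989, Eq. (1)].
-/

noncomputable section

namespace Summit.Ventures.CertifiedManyBodySolver.Downfold.Emery

open Real Set
open Summit.Ventures.CertifiedManyBodySolver.Downfold

/-! ## §1 Slab windows (raw co-shifted coordinates `t_pp′ := t_pp + a`, `c′ := t_pp′ + a`) -/

/-- **Slab 0, a ∈ [0, 0.15] eV**: on the co-shifted box (t_pp + a ∈ [0.68, 0.94], t_pp′ + a ∈ [0.1156, 0.2656]) at per-spin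
filling ∈ [0.42, 0.4375]: `ε_F ∈ [1.44, 2.9]` and `t′/t ∈ [-0.3762, -0.2412]` — SHORT vs the E row. [folklore] -/
theorem hg1201p10AxSlab0_window {Δ tpd tpp c ε : ℝ} (hΔ : Δ ∈ Set.Icc (23 / 20 : ℝ) (5 / 2 : ℝ))
    (ha : tpd ∈ Set.Icc (139 / 100 : ℝ) (77 / 50 : ℝ)) (hb : tpp ∈ Set.Icc (17 / 25 : ℝ) (47 / 50 : ℝ))
    (hc : c ∈ Set.Icc (289 / 2500 : ℝ) (166 / 625 : ℝ))
    (hν : abFilling Δ tpd tpp c ε ∈ Set.Icc (21 / 50 : ℝ) (7 / 16 : ℝ)) :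
    ε ∈ Set.Icc (36 / 25 : ℝ) (29 / 10 : ℝ) ∧ fsRatio Δ tpd tpp c ε ∈ Set.Icc (-(1881 / 5000 : ℝ)) (-(603 / 2500 : ℝ)) := by
  have hΔ' := hΔ
  constructor
  · clear hΔ
    rcases mem_Icc_split hΔ' (73 / 40 : ℝ) with hΔ' | hΔ'
    · rcases mem_Icc_split hΔ' (119 / 80 : ℝ) with hΔ' | hΔ'
      · have h := (hg1201p10Ax0Sub_0_0 hΔ' ha hb hc hν).1
        exact ⟨le_trans (by norm_num) h.1, h.2.trans (by norm_num)⟩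
      · have h := (hg1201p10Ax0Sub_1_0 hΔ' ha hb hc hν).1
        exact ⟨le_trans (by norm_num) h.1, h.2.trans (by norm_num)⟩
    · rcases mem_Icc_split hΔ' (173 / 80 : ℝ) with hΔ' | hΔ'
      · have h := (hg1201p10Ax0Sub_2_0 hΔ' ha hb hc hν).1
        exact ⟨le_trans (by norm_num) h.1, h.2.trans (by norm_num)⟩
      · have h := (hg1201p10Ax0Sub_3_0 hΔ' ha hb hc hν).1
        exact ⟨le_trans (by norm_num) h.1, h.2.trans (by norm_num)⟩
  · clear hΔ
    rcases mem_Icc_split hΔ' (73 / 40 : ℝ) with hΔ' | hΔ'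
    · rcases mem_Icc_split hΔ' (119 / 80 : ℝ) with hΔ' | hΔ'
      · have h := (hg1201p10Ax0Sub_0_0 hΔ' ha hb hc hν).2
        exact ⟨le_trans (by norm_num) h.1, h.2.trans (by norm_num)⟩
      · have h := (hg1201p10Ax0Sub_1_0 hΔ' ha hb hc hν).2
        exact ⟨le_trans (by norm_num) h.1, h.2.trans (by norm_num)⟩
    · rcases mem_Icc_split hΔ' (173 / 80 : ℝ) with hΔ' | hΔ'
      · have h := (hg1201p10Ax0Sub_2_0 hΔ' ha hb hc hν).2
        exact ⟨le_trans (by norm_num) h.1, h.2.trans (by norm_num)⟩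
      · have h := (hg1201p10Ax0Sub_3_0 hΔ' ha hb hc hν).2
        exact ⟨le_trans (by norm_num) h.1, h.2.trans (by norm_num)⟩

/-- **Slab 1, a ∈ [0.15, 0.3] eV**: on the co-shifted box (t_pp + a ∈ [0.83, 1.09], t_pp′ + a ∈ [0.2656, 0.4156]) at per-spin
filling ∈ [0.42, 0.4375]: `ε_F ∈ [1.38, 2.8]` and `t′/t ∈ [-0.4267, -0.3021]` — SHORT vs the E row. [folklore] -/
theorem hg1201p10AxSlab1_window {Δ tpd tpp c ε : ℝ} (hΔ : Δ ∈ Set.Icc (23 / 20 : ℝ) (5 / 2 : ℝ))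
    (ha : tpd ∈ Set.Icc (139 / 100 : ℝ) (77 / 50 : ℝ)) (hb : tpp ∈ Set.Icc (83 / 100 : ℝ) (109 / 100 : ℝ))
    (hc : c ∈ Set.Icc (166 / 625 : ℝ) (1039 / 2500 : ℝ))
    (hν : abFilling Δ tpd tpp c ε ∈ Set.Icc (21 / 50 : ℝ) (7 / 16 : ℝ)) :
    ε ∈ Set.Icc (69 / 50 : ℝ) (14 / 5 : ℝ) ∧ fsRatio Δ tpd tpp c ε ∈ Set.Icc (-(4267 / 10000 : ℝ)) (-(3021 / 10000 : ℝ)) := by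
  have hΔ' := hΔ
  constructor
  · clear hΔ
    rcases mem_Icc_split hΔ' (73 / 40 : ℝ) with hΔ' | hΔ'
    · rcases mem_Icc_split hΔ' (119 / 80 : ℝ) with hΔ' | hΔ'
      · have h := (hg1201p10Ax1Sub_0_0 hΔ' ha hb hc hν).1
        exact ⟨le_trans (by norm_num) h.1, h.2.trans (by norm_num)⟩
      · have h := (hg1201p10Ax1Sub_1_0 hΔ' ha hb hc hν).1
        exact ⟨le_trans (by norm_num) h.1, h.2.trans (by norm_num)⟩
    · rcases mem_Icc_split hΔ' (173 / 80 : ℝ) with hΔ' | hΔ'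
      · have h := (hg1201p10Ax1Sub_2_0 hΔ' ha hb hc hν).1
        exact ⟨le_trans (by norm_num) h.1, h.2.trans (by norm_num)⟩
      · have h := (hg1201p10Ax1Sub_3_0 hΔ' ha hb hc hν).1
        exact ⟨le_trans (by norm_num) h.1, h.2.trans (by norm_num)⟩
  · clear hΔ
    rcases mem_Icc_split hΔ' (73 / 40 : ℝ) with hΔ' | hΔ'
    · rcases mem_Icc_split hΔ' (119 / 80 : ℝ) with hΔ' | hΔ'
      · have h := (hg1201p10Ax1Sub_0_0 hΔ' ha hb hc hν).2
        exact ⟨le_trans (by norm_num) h.1, h.2.trans (by norm_num)⟩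
      · have h := (hg1201p10Ax1Sub_1_0 hΔ' ha hb hc hν).2
        exact ⟨le_trans (by norm_num) h.1, h.2.trans (by norm_num)⟩
    · rcases mem_Icc_split hΔ' (173 / 80 : ℝ) with hΔ' | hΔ'
      · have h := (hg1201p10Ax1Sub_2_0 hΔ' ha hb hc hν).2
        exact ⟨le_trans (by norm_num) h.1, h.2.trans (by norm_num)⟩
      · have h := (hg1201p10Ax1Sub_3_0 hΔ' ha hb hc hν).2
        exact ⟨le_trans (by norm_num) h.1, h.2.trans (by norm_num)⟩

/-- **Slab 2, a ∈ [0.3, 0.35] eV**: on the co-shifted box (t_pp + a ∈ [0.98, 1.14], t_pp′ + a ∈ [0.4156, 0.4656]) at per-spin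
filling ∈ [0.42, 0.4375]: `ε_F ∈ [1.4, 2.66]` and `t′/t ∈ [-0.4375, -0.3429]` — SHORT vs the E row. [folklore] -/
theorem hg1201p10AxSlab2_window {Δ tpd tpp c ε : ℝ} (hΔ : Δ ∈ Set.Icc (23 / 20 : ℝ) (5 / 2 : ℝ))
    (ha : tpd ∈ Set.Icc (139 / 100 : ℝ) (77 / 50 : ℝ)) (hb : tpp ∈ Set.Icc (49 / 50 : ℝ) (57 / 50 : ℝ))
    (hc : c ∈ Set.Icc (1039 / 2500 : ℝ) (291 / 625 : ℝ))
    (hν : abFilling Δ tpd tpp c ε ∈ Set.Icc (21 / 50 : ℝ) (7 / 16 : ℝ)) :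
    ε ∈ Set.Icc (7 / 5 : ℝ) (133 / 50 : ℝ) ∧ fsRatio Δ tpd tpp c ε ∈ Set.Icc (-(7 / 16 : ℝ)) (-(3429 / 10000 : ℝ)) := by
  have hΔ' := hΔ
  constructor
  · clear hΔ
    rcases mem_Icc_split hΔ' (73 / 40 : ℝ) with hΔ' | hΔ'
    · rcases mem_Icc_split hΔ' (119 / 80 : ℝ) with hΔ' | hΔ'
      · have h := (hg1201p10Ax2Sub_0_0 hΔ' ha hb hc hν).1
        exact ⟨le_trans (by norm_num) h.1, h.2.trans (by norm_num)⟩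
      · have h := (hg1201p10Ax2Sub_1_0 hΔ' ha hb hc hν).1
        exact ⟨le_trans (by norm_num) h.1, h.2.trans (by norm_num)⟩
    · rcases mem_Icc_split hΔ' (173 / 80 : ℝ) with hΔ' | hΔ'
      · have h := (hg1201p10Ax2Sub_2_0 hΔ' ha hb hc hν).1
        exact ⟨le_trans (by norm_num) h.1, h.2.trans (by norm_num)⟩
      · have h := (hg1201p10Ax2Sub_3_0 hΔ' ha hb hc hν).1
        exact ⟨le_trans (by norm_num) h.1, h.2.trans (by norm_num)⟩
  · clear hΔ
    rcases mem_Icc_split hΔ' (73 / 40 : ℝ) with hΔ' | hΔ'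
    · rcases mem_Icc_split hΔ' (119 / 80 : ℝ) with hΔ' | hΔ'
      · have h := (hg1201p10Ax2Sub_0_0 hΔ' ha hb hc hν).2
        exact ⟨le_trans (by norm_num) h.1, h.2.trans (by norm_num)⟩
      · have h := (hg1201p10Ax2Sub_1_0 hΔ' ha hb hc hν).2
        exact ⟨le_trans (by norm_num) h.1, h.2.trans (by norm_num)⟩
    · rcases mem_Icc_split hΔ' (173 / 80 : ℝ) with hΔ' | hΔ'
      · have h := (hg1201p10Ax2Sub_2_0 hΔ' ha hb hc hν).2
        exact ⟨le_trans (by norm_num) h.1, h.2.trans (by norm_num)⟩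
      · have h := (hg1201p10Ax2Sub_3_0 hΔ' ha hb hc hν).2
        exact ⟨le_trans (by norm_num) h.1, h.2.trans (by norm_num)⟩

/-- **Slab 3, a ∈ [0.35, 0.4] eV**: on the co-shifted box (t_pp + a ∈ [1.03, 1.19], t_pp′ + a ∈ [0.4656, 0.5156]) at per-spin
filling ∈ [0.42, 0.4375]: `ε_F ∈ [1.38, 2.62]` and `t′/t ∈ [-0.4496, -0.3541]` — SHORT vs the E row. [folklore] -/
theorem hg1201p10AxSlab3_window {Δ tpd tpp c ε : ℝ} (hΔ : Δ ∈ Set.Icc (23 / 20 : ℝ) (5 / 2 : ℝ))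
    (ha : tpd ∈ Set.Icc (139 / 100 : ℝ) (77 / 50 : ℝ)) (hb : tpp ∈ Set.Icc (103 / 100 : ℝ) (119 / 100 : ℝ))
    (hc : c ∈ Set.Icc (291 / 625 : ℝ) (1289 / 2500 : ℝ))
    (hν : abFilling Δ tpd tpp c ε ∈ Set.Icc (21 / 50 : ℝ) (7 / 16 : ℝ)) :
    ε ∈ Set.Icc (69 / 50 : ℝ) (131 / 50 : ℝ) ∧ fsRatio Δ tpd tpp c ε ∈ Set.Icc (-(281 / 625 : ℝ)) (-(3541 / 10000 : ℝ)) := by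
  have hΔ' := hΔ
  constructor
  · clear hΔ
    rcases mem_Icc_split hΔ' (73 / 40 : ℝ) with hΔ' | hΔ'
    · rcases mem_Icc_split hΔ' (119 / 80 : ℝ) with hΔ' | hΔ'
      · have h := (hg1201p10Ax3Sub_0_0 hΔ' ha hb hc hν).1
        exact ⟨le_trans (by norm_num) h.1, h.2.trans (by norm_num)⟩
      · have h := (hg1201p10Ax3Sub_1_0 hΔ' ha hb hc hν).1
        exact ⟨le_trans (by norm_num) h.1, h.2.trans (by norm_num)⟩
    · rcases mem_Icc_split hΔ' (173 / 80 : ℝ) with hΔ' | hΔ'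
      · have h := (hg1201p10Ax3Sub_2_0 hΔ' ha hb hc hν).1
        exact ⟨le_trans (by norm_num) h.1, h.2.trans (by norm_num)⟩
      · have h := (hg1201p10Ax3Sub_3_0 hΔ' ha hb hc hν).1
        exact ⟨le_trans (by norm_num) h.1, h.2.trans (by norm_num)⟩
  · clear hΔ
    rcases mem_Icc_split hΔ' (73 / 40 : ℝ) with hΔ' | hΔ'
    · rcases mem_Icc_split hΔ' (119 / 80 : ℝ) with hΔ' | hΔ'
      · have h := (hg1201p10Ax3Sub_0_0 hΔ' ha hb hc hν).2
        exact ⟨le_trans (by norm_num) h.1, h.2.trans (by norm_num)⟩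
      · have h := (hg1201p10Ax3Sub_1_0 hΔ' ha hb hc hν).2
        exact ⟨le_trans (by norm_num) h.1, h.2.trans (by norm_num)⟩
    · rcases mem_Icc_split hΔ' (173 / 80 : ℝ) with hΔ' | hΔ'
      · have h := (hg1201p10Ax3Sub_2_0 hΔ' ha hb hc hν).2
        exact ⟨le_trans (by norm_num) h.1, h.2.trans (by norm_num)⟩
      · have h := (hg1201p10Ax3Sub_3_0 hΔ' ha hb hc hν).2
        exact ⟨le_trans (by norm_num) h.1, h.2.trans (by norm_num)⟩

/-- **Slab 4, a ∈ [0.4, 0.45] eV**: on the co-shifted box (t_pp + a ∈ [1.08, 1.24], t_pp′ + a ∈ [0.5156, 0.5656]) at per-spin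
filling ∈ [0.42, 0.4375]: `ε_F ∈ [1.36, 2.62]` and `t′/t ∈ [-0.4621, -0.3645]` — MEETS vs the E row. [folklore] -/
theorem hg1201p10AxSlab4_window {Δ tpd tpp c ε : ℝ} (hΔ : Δ ∈ Set.Icc (23 / 20 : ℝ) (5 / 2 : ℝ))
    (ha : tpd ∈ Set.Icc (139 / 100 : ℝ) (77 / 50 : ℝ)) (hb : tpp ∈ Set.Icc (27 / 25 : ℝ) (31 / 25 : ℝ))
    (hc : c ∈ Set.Icc (1289 / 2500 : ℝ) (707 / 1250 : ℝ))
    (hν : abFilling Δ tpd tpp c ε ∈ Set.Icc (21 / 50 : ℝ) (7 / 16 : ℝ)) :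
    ε ∈ Set.Icc (34 / 25 : ℝ) (131 / 50 : ℝ) ∧ fsRatio Δ tpd tpp c ε ∈ Set.Icc (-(4621 / 10000 : ℝ)) (-(729 / 2000 : ℝ)) := by
  have hΔ' := hΔ
  constructor
  · clear hΔ
    rcases mem_Icc_split hΔ' (73 / 40 : ℝ) with hΔ' | hΔ'
    · rcases mem_Icc_split hΔ' (119 / 80 : ℝ) with hΔ' | hΔ'
      · have h := (hg1201p10Ax4Sub_0_0 hΔ' ha hb hc hν).1
        exact ⟨le_trans (by norm_num) h.1, h.2.trans (by norm_num)⟩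
      · have h := (hg1201p10Ax4Sub_1_0 hΔ' ha hb hc hν).1
        exact ⟨le_trans (by norm_num) h.1, h.2.trans (by norm_num)⟩
    · rcases mem_Icc_split hΔ' (173 / 80 : ℝ) with hΔ' | hΔ'
      · have h := (hg1201p10Ax4Sub_2_0 hΔ' ha hb hc hν).1
        exact ⟨le_trans (by norm_num) h.1, h.2.trans (by norm_num)⟩
      · have h := (hg1201p10Ax4Sub_3_0 hΔ' ha hb hc hν).1
        exact ⟨le_trans (by norm_num) h.1, h.2.trans (by norm_num)⟩
  · clear hΔ
    rcases mem_Icc_split hΔ' (73 / 40 : ℝ) with hΔ' | hΔ'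
    · rcases mem_Icc_split hΔ' (119 / 80 : ℝ) with hΔ' | hΔ'
      · have h := (hg1201p10Ax4Sub_0_0 hΔ' ha hb hc hν).2
        exact ⟨le_trans (by norm_num) h.1, h.2.trans (by norm_num)⟩
      · have h := (hg1201p10Ax4Sub_1_0 hΔ' ha hb hc hν).2
        exact ⟨le_trans (by norm_num) h.1, h.2.trans (by norm_num)⟩
    · rcases mem_Icc_split hΔ' (173 / 80 : ℝ) with hΔ' | hΔ'
      · have h := (hg1201p10Ax4Sub_2_0 hΔ' ha hb hc hν).2
        exact ⟨le_trans (by norm_num) h.1, h.2.trans (by norm_num)⟩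
      · have h := (hg1201p10Ax4Sub_3_0 hΔ' ha hb hc hν).2
        exact ⟨le_trans (by norm_num) h.1, h.2.trans (by norm_num)⟩

/-- **Slab 5, a ∈ [0.45, 0.5] eV**: on the co-shifted box (t_pp + a ∈ [1.13, 1.29], t_pp′ + a ∈ [0.5656, 0.6156]) at per-spin
filling ∈ [0.42, 0.4375]: `ε_F ∈ [1.34, 2.58]` and `t′/t ∈ [-0.4722, -0.374]` — MEETS vs the E row. [folklore] -/
theorem hg1201p10AxSlab5_window {Δ tpd tpp c ε : ℝ} (hΔ : Δ ∈ Set.Icc (23 / 20 : ℝ) (5 / 2 : ℝ))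
    (ha : tpd ∈ Set.Icc (139 / 100 : ℝ) (77 / 50 : ℝ)) (hb : tpp ∈ Set.Icc (113 / 100 : ℝ) (129 / 100 : ℝ))
    (hc : c ∈ Set.Icc (707 / 1250 : ℝ) (1539 / 2500 : ℝ))
    (hν : abFilling Δ tpd tpp c ε ∈ Set.Icc (21 / 50 : ℝ) (7 / 16 : ℝ)) :
    ε ∈ Set.Icc (67 / 50 : ℝ) (129 / 50 : ℝ) ∧ fsRatio Δ tpd tpp c ε ∈ Set.Icc (-(2361 / 5000 : ℝ)) (-(187 / 500 : ℝ)) := by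
  have hΔ' := hΔ
  constructor
  · clear hΔ
    rcases mem_Icc_split hΔ' (73 / 40 : ℝ) with hΔ' | hΔ'
    · rcases mem_Icc_split hΔ' (119 / 80 : ℝ) with hΔ' | hΔ'
      · have h := (hg1201p10Ax5Sub_0_0 hΔ' ha hb hc hν).1
        exact ⟨le_trans (by norm_num) h.1, h.2.trans (by norm_num)⟩
      · have h := (hg1201p10Ax5Sub_1_0 hΔ' ha hb hc hν).1
        exact ⟨le_trans (by norm_num) h.1, h.2.trans (by norm_num)⟩
    · rcases mem_Icc_split hΔ' (173 / 80 : ℝ) with hΔ' | hΔ'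
      · have h := (hg1201p10Ax5Sub_2_0 hΔ' ha hb hc hν).1
        exact ⟨le_trans (by norm_num) h.1, h.2.trans (by norm_num)⟩
      · have h := (hg1201p10Ax5Sub_3_0 hΔ' ha hb hc hν).1
        exact ⟨le_trans (by norm_num) h.1, h.2.trans (by norm_num)⟩
  · clear hΔ
    rcases mem_Icc_split hΔ' (73 / 40 : ℝ) with hΔ' | hΔ'
    · rcases mem_Icc_split hΔ' (119 / 80 : ℝ) with hΔ' | hΔ'
      · have h := (hg1201p10Ax5Sub_0_0 hΔ' ha hb hc hν).2
        exact ⟨le_trans (by norm_num) h.1, h.2.trans (by norm_num)⟩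
      · have h := (hg1201p10Ax5Sub_1_0 hΔ' ha hb hc hν).2
        exact ⟨le_trans (by norm_num) h.1, h.2.trans (by norm_num)⟩
    · rcases mem_Icc_split hΔ' (173 / 80 : ℝ) with hΔ' | hΔ'
      · have h := (hg1201p10Ax5Sub_2_0 hΔ' ha hb hc hν).2
        exact ⟨le_trans (by norm_num) h.1, h.2.trans (by norm_num)⟩
      · have h := (hg1201p10Ax5Sub_3_0 hΔ' ha hb hc hν).2
        exact ⟨le_trans (by norm_num) h.1, h.2.trans (by norm_num)⟩

/-- **Slab 6, a ∈ [0.5, 0.6] eV**: on the co-shifted box (t_pp + a ∈ [1.18, 1.39], t_pp′ + a ∈ [0.6156, 0.7156]) at per-spin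
filling ∈ [0.42, 0.4375]: `ε_F ∈ [1.3, 2.6]` and `t′/t ∈ [-0.4945, -0.3822]` — MEETS vs the E row. [folklore] -/
theorem hg1201p10AxSlab6_window {Δ tpd tpp c ε : ℝ} (hΔ : Δ ∈ Set.Icc (23 / 20 : ℝ) (5 / 2 : ℝ))
    (ha : tpd ∈ Set.Icc (139 / 100 : ℝ) (77 / 50 : ℝ)) (hb : tpp ∈ Set.Icc (59 / 50 : ℝ) (139 / 100 : ℝ))
    (hc : c ∈ Set.Icc (1539 / 2500 : ℝ) (1789 / 2500 : ℝ))
    (hν : abFilling Δ tpd tpp c ε ∈ Set.Icc (21 / 50 : ℝ) (7 / 16 : ℝ)) :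
    ε ∈ Set.Icc (13 / 10 : ℝ) (13 / 5 : ℝ) ∧ fsRatio Δ tpd tpp c ε ∈ Set.Icc (-(989 / 2000 : ℝ)) (-(1911 / 5000 : ℝ)) := by
  have hΔ' := hΔ
  constructor
  · clear hΔ
    rcases mem_Icc_split hΔ' (73 / 40 : ℝ) with hΔ' | hΔ'
    · rcases mem_Icc_split hΔ' (119 / 80 : ℝ) with hΔ' | hΔ'
      · have h := (hg1201p10Ax6Sub_0_0 hΔ' ha hb hc hν).1
        exact ⟨le_trans (by norm_num) h.1, h.2.trans (by norm_num)⟩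
      · have h := (hg1201p10Ax6Sub_1_0 hΔ' ha hb hc hν).1
        exact ⟨le_trans (by norm_num) h.1, h.2.trans (by norm_num)⟩
    · rcases mem_Icc_split hΔ' (173 / 80 : ℝ) with hΔ' | hΔ'
      · have h := (hg1201p10Ax6Sub_2_0 hΔ' ha hb hc hν).1
        exact ⟨le_trans (by norm_num) h.1, h.2.trans (by norm_num)⟩
      · have h := (hg1201p10Ax6Sub_3_0 hΔ' ha hb hc hν).1
        exact ⟨le_trans (by norm_num) h.1, h.2.trans (by norm_num)⟩
  · clear hΔ
    rcases mem_Icc_split hΔ' (73 / 40 : ℝ) with hΔ' | hΔ'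
    · rcases mem_Icc_split hΔ' (119 / 80 : ℝ) with hΔ' | hΔ'
      · have h := (hg1201p10Ax6Sub_0_0 hΔ' ha hb hc hν).2
        exact ⟨le_trans (by norm_num) h.1, h.2.trans (by norm_num)⟩
      · have h := (hg1201p10Ax6Sub_1_0 hΔ' ha hb hc hν).2
        exact ⟨le_trans (by norm_num) h.1, h.2.trans (by norm_num)⟩
    · rcases mem_Icc_split hΔ' (173 / 80 : ℝ) with hΔ' | hΔ'
      · have h := (hg1201p10Ax6Sub_2_0 hΔ' ha hb hc hν).2
        exact ⟨le_trans (by norm_num) h.1, h.2.trans (by norm_num)⟩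
      · have h := (hg1201p10Ax6Sub_3_0 hΔ' ha hb hc hν).2
        exact ⟨le_trans (by norm_num) h.1, h.2.trans (by norm_num)⟩

end Summit.Ventures.CertifiedManyBodySolver.Downfold.Emery
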